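import Literature.Analysis.FluidPDE.KochTataruBilinearEstimate
import HarnessLib

/-!
# Koch–Tataru's Theorem 2 for the integral equation (11): uniqueness (T2), discharged, and `koch_tataru` from (T3), (T4)

Analysis/FluidPDE proof companion of `Literature/Analysis/FluidPDE/KochTataru.lean` (the
decomposition of the named fact `Literature.Analysis.FluidPDE.koch_tataru`, **ns.S15**,
Koch–Tataru, Adv. Math. 157 (2001), Theorem 2, into (L1), (L2), (T1)–(T4)). With (L1)
discharged (`kochTataruBilinear_estimate_holds`, `KochTataruBilinearEstimate.lean`) the contraction
estimate of `KochTataruFixedPoint.lean` (`kochTataru_integral_unique_of : (L1) → (T2)`) gives the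
uniqueness half of Theorem 2 for the integral equation (11): **`kochTataru_integral_unique_holds`**;
and together with (L2) (`eKochTataruNorm_heatExtension_le_holds`, `KochTataruLinear.lean`) and the
fixed point (`kochTataru_integral_exists_of`), the assembly `koch_tataru_of` of `KochTataru.lean`
reduces the named fact `koch_tataru` (on `ℝ³`) to the two passages between the integral equation
and Koch–Tataru's class: **`koch_tataru_of_T3_T4 : (T3) → (T4) → koch_tataru`**. One-line
assemblies of proved results; no new definitions.

## References

* H. Koch, D. Tataru, *Well-posedness for the Navier–Stokes equations*, Adv. Math. 157 (2001)
  22–35, Theorem 2 and §3 ((11), Lemmas 3.1–3.2). Bib key `KochTataruAdvMath2001`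
  (held: doi:10.1006/aima.2000.1937, pp. 3 and 6 of the preprint).
* P. G. Lemarié-Rieusset, *The Navier–Stokes problem in the 21st century*, CRC Press 2016,
  Thm. 9.2. Bib key `LemarieRieusset2016`.
-/

noncomputable section

namespace Literature.Analysis.FluidPDE

section General

variable (E : Type*) [NormedAddCommGroup E] [InnerProductSpace ℝ E] [FiniteDimensional ℝ E]
  [MeasurableSpace E] [BorelSpace E]

/-- **(T2) Koch–Tataru's Theorem 2 for the integral equation, uniqueness, discharged** (Adv. Math.
157 (2001), Theorem 2: the small solution of (11) in `X` is unique — the fixed-point map is a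
contraction on a small ball of `X` by Lemmas 3.1–3.2): the named fact `kochTataru_integral_unique`
holds in every finite-dimensional real inner product space — there is `ε > 0` such that two fields
measurable on `(0, ∞) × E`, solving (11) a.e. on every positive slice with the same datum and with
`‖u‖_X, ‖v‖_X ≤ ε`, agree a.e. on every positive slice. Proof: `kochTataru_integral_unique_of` with
the bilinear estimate (L1) (`kochTataruBilinear_estimate_holds`). [cite: KochTataruAdvMath2001, Theorem 2 (uniqueness) with §3 (11)] -/
theorem kochTataru_integral_unique_holds : kochTataru_integral_unique E :=
  kochTataru_integral_unique_of E kochTataruBilinear_estimate_holds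

end General

section Summit

/-- Local notation for physical space `ℝ³ = EuclideanSpace ℝ (Fin 3)`. -/
local notation "ℝ³" => EuclideanSpace ℝ (Fin 3)

/-- **`koch_tataru` from (T3) and (T4)** (Koch–Tataru 2001, Theorem 2 and §3): with (L1)
(`kochTataruBilinear_estimate_holds`), (L2) (`eKochTataruNorm_heatExtension_le_holds`), hence (T1)
(`kochTataru_integral_exists_of`) and (T2) (`kochTataru_integral_unique_of`) proved, the named fact
`koch_tataru` (**ns.S15**, on `ℝ³`) follows from the two passages between the integral equation
(11) and Koch–Tataru's class, (T3) `isKochTataruSolution_of_integral` and (T4)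
`integral_of_isKochTataruSolution`, by the assembly `koch_tataru_of` of `KochTataru.lean`.
[cite: KochTataruAdvMath2001, Theorem 2 and §3] -/
theorem koch_tataru_of_T3_T4 (hMILD : isKochTataruSolution_of_integral ℝ³)
    (hCONV : integral_of_isKochTataruSolution ℝ³) : koch_tataru :=
  koch_tataru_of
    (kochTataru_integral_exists_of ℝ³ kochTataruBilinear_estimate_holds
      (eKochTataruNorm_heatExtension_le_holds ℝ³))
    (kochTataru_integral_unique_of ℝ³ kochTataruBilinear_estimate_holds) hMILD hCONV

end Summit

end Literature.Analysis.FluidPDE
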